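import Mathlib
import Literature.AlgebraicGeometry.Resolution.TranscendenceDefect
import Literature.RingTheory.KrullDimension.AffineDimension
import HarnessLib

/-!
# Lens 5 — class (B) input: a valuation ring with no proper coarsening has an ARCHIMEDEAN value group

T-port from `Cruxes/DescentPerfectToAll/Lens5_RankOneArchimedean.lean` rev 4.
Original author: res-B-lens-5.  OURS; nothing here proves resolution in characteristic `p`.

Crux workfile on `stmt-ResolutionOfSingularities-0549` (`Theses.Descent.DescentPerfectToAll`); customer = the T-slice port, class (B) of
THEOREM T (memo `CLASSBC-prank2-toric-lens5-g9.md` §3): `Lens5_UnimodularRefinement.toric_lemma_classB` asks for `[Archimedean W]` on the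
(additive) value group `W`.  In the port `W = Additive (ValuationSubring.ValueGroup O)ˣ` (the group whose `ℤ`-rank is the tree's `ratRank O`),
and class (B) is the case "no valuation ring strictly between `O` and `K`" (no height-one coarsening `O₁`).  This file proves, sorry-free and
def-free, that in that case the value group is archimedean — the standard prime-ideal argument: if no power of `x ∈ 𝔪_O` fell into `yO`, a
prime `𝔭 ⊇ yO` avoiding the powers of `x` (`Ideal.exists_le_prime_disjoint`) would give the coarsening `O_𝔭 = ofPrime O 𝔭` with `O < O_𝔭 < K`.

## Contents
* `exists_valuation_pow_le` — `v(x) < 1`, `y ≠ 0` ⟹ `∃ n, v(x)^n ≤ v(y)` (K-level form).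
* `mulArchimedean_valueGroup_units` — `MulArchimedean (ValueGroup O)ˣ`; hence (Mathlib instance) `Archimedean (Additive (ValueGroup O)ˣ)`,
  recorded as `archimedean_additive_valueGroup_units`.
* (rev 2, class (C)) `ker_pair_dependent_of_rank_le_two`, `image_pair_dependent_of_rank_le_two`, `pair_dependent_of_rank_le_two_of_surjective`
  — the hypotheses (hΔ), (hW₁) of `exists_two_level_reading` from `rank_ℤ W ≤ 2` + a non-zero kernel element + a non-zero value.
* (rev 3) `exists_ne_zero_map_eq_zero_of_rank_le_two` — the hypothesis `hrel` of `toric_lemma_classB/C` from `rank_ℤ W ≤ 2`.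
* (rev 4) `ratRank_le_two_of_transcendenceDefect_ne_zero` / `ratRank_le_two_of_stub` — `rank_ℤ W ≤ 2` from the stub's (htd) via the
  tree's `D + E + F = N`; `eq_top_of_subfield_le_of_isAlgebraic` — the `hne` witness of `exists_two_level_reading` (a proper coarsening is
  non-trivial on any subfield over which `K` is algebraic).
[folklore; e.g. Bourbaki AC VI §4.5 Prop. 8 / Engler–Prestel Thm 2.3.x: rank one ⟺ archimedean]
-/

set_option linter.dupNamespace false

namespace Summit.ResolutionOfSingularities.ResolutionOfSingularities.Theorems.RadicialJung.CleanModels.Lens5RankOneArchimedean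

open ValuationSubring

variable {K : Type} [Field K]

/-- **No proper coarsening ⟹ archimedean (element form).**  If the only valuation subrings of `K` containing `O` are `O` and `K`, then for
`x` of value `< 1` and `y ≠ 0` some power of `v(x)` is `≤ v(y)`. [folklore] -/
theorem exists_valuation_pow_le (O : ValuationSubring K) (hmax : ∀ O₁ : ValuationSubring K, O ≤ O₁ → O₁ = O ∨ O₁ = ⊤)
    (x y : K) (hx : O.valuation x < 1) (hy : y ≠ 0) : ∃ n : ℕ, O.valuation x ^ n ≤ O.valuation y := by
  classical
  by_cases hx0 : x = 0
  · exact ⟨1, by simp [hx0]⟩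
  by_cases hy1 : 1 ≤ O.valuation y
  · exact ⟨0, by simpa using hy1⟩
  rw [not_le] at hy1
  have hxO : x ∈ O := (O.valuation_le_one_iff x).mp hx.le
  have hyO : y ∈ O := (O.valuation_le_one_iff y).mp hy1.le
  by_contra H
  rw [not_exists] at H
  -- the ideal `yO` misses all powers of `x`
  set a : O := ⟨x, hxO⟩ with ha
  set b : O := ⟨y, hyO⟩ with hb
  have hdisj : Disjoint ((Ideal.span {b} : Ideal O) : Set O) (Submonoid.powers a) := by
    rw [Set.disjoint_left]
    rintro c hc ⟨n, rfl⟩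
    obtain ⟨d, hd⟩ := Ideal.mem_span_singleton'.mp hc
    apply H n
    have hval : O.valuation ((d : K) * y) = O.valuation (x ^ n) := by
      have := congrArg (fun z : O => (z : K)) hd
      simpa [ha, hb] using congrArg O.valuation this
    calc O.valuation x ^ n = O.valuation (x ^ n) := (map_pow _ _ _).symm
      _ = O.valuation (d : K) * O.valuation y := by rw [← hval, map_mul]
      _ ≤ 1 * O.valuation y := by
          exact mul_le_mul_of_nonneg_right ((O.valuation_le_one_iff _).mpr d.2) zero_le
      _ = O.valuation y := one_mul _
  obtain ⟨P, hP, hIP, hPS⟩ := Ideal.exists_le_prime_disjoint (Ideal.span {b}) (Submonoid.powers a) hdisj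
  haveI := hP
  have haP : a ∉ P := fun h => Set.disjoint_left.mp hPS h ⟨1, pow_one a⟩
  have hbP : b ∈ P := hIP (Ideal.mem_span_singleton_self b)
  rcases hmax (ofPrime O P) (le_ofPrime O P) with h1 | h1
  · -- `O_P = O`: then `x` is a unit of `O`, contradicting `v(x) < 1`
    have hv1 : (ofPrime O P).valuation (a : K) = 1 := (ofPrime_valuation_eq_one_iff_mem_primeCompl O P a).mpr haP
    have hv1' : (ofPrime O P).valuation x = 1 := hv1
    have hxinv : x⁻¹ ∈ ofPrime O P := by
      apply mem_of_valuation_le_one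
      rw [map_inv₀, hv1', inv_one]
    rw [h1] at hxinv
    have h2 : O.valuation x⁻¹ ≤ 1 := (O.valuation_le_one_iff _).mpr hxinv
    rw [map_inv₀, inv_le_one₀ ((Valuation.pos_iff _).mpr hx0)] at h2
    exact absurd hx (not_lt.mpr h2)
  · -- `O_P = K`: then `y` is a unit of `O_P`, contradicting `y ∈ P`
    have hyinv : y⁻¹ ∈ ofPrime O P := by rw [h1]; exact mem_top _
    have hv1 : (ofPrime O P).valuation y = 1 := by
      apply le_antisymm (((ofPrime O P).valuation_le_one_iff y).mpr (le_ofPrime O P hyO))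
      have h2 : (ofPrime O P).valuation y⁻¹ ≤ 1 := ((ofPrime O P).valuation_le_one_iff _).mpr hyinv
      rwa [map_inv₀, inv_le_one₀ ((Valuation.pos_iff _).mpr hy)] at h2
    have hbP' : b ∈ P.primeCompl := (ofPrime_valuation_eq_one_iff_mem_primeCompl O P b).mp hv1
    exact hbP' hbP

/-- **No proper coarsening ⟹ the value group `Γ_O = (ValueGroup O)ˣ` is (multiplicatively) archimedean.** [folklore] -/
theorem mulArchimedean_valueGroup_units (O : ValuationSubring K)
    (hmax : ∀ O₁ : ValuationSubring K, O ≤ O₁ → O₁ = O ∨ O₁ = ⊤) : MulArchimedean (ValueGroup O)ˣ := by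
  refine ⟨fun u w hw => ?_⟩
  obtain ⟨x₀, hx₀⟩ := O.valuation_surjective (u : ValueGroup O)
  obtain ⟨y₀, hy₀⟩ := O.valuation_surjective (w : ValueGroup O)
  have hx₀0 : x₀ ≠ 0 := fun h => u.ne_zero (by rw [← hx₀, h, map_zero])
  have hy₀0 : y₀ ≠ 0 := fun h => w.ne_zero (by rw [← hy₀, h, map_zero])
  have hupos : (0 : ValueGroup O) < u := zero_lt_iff.mpr u.ne_zero
  have hwpos : (0 : ValueGroup O) < w := zero_lt_iff.mpr w.ne_zero
  have hw' : (1 : ValueGroup O) < w := by exact_mod_cast hw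
  have hlt : O.valuation y₀⁻¹ < 1 := by
    rw [map_inv₀, hy₀]
    exact inv_lt_one_of_one_lt₀ hw'
  obtain ⟨n, hn⟩ := exists_valuation_pow_le O hmax y₀⁻¹ x₀⁻¹ hlt (inv_ne_zero hx₀0)
  rw [map_inv₀, map_inv₀, hx₀, hy₀, inv_pow, inv_le_inv₀ (pow_pos hwpos n) hupos] at hn
  refine ⟨n, ?_⟩
  exact_mod_cast hn

/-- **The additive form the toric lemma consumes: `Archimedean (Additive (ValueGroup O)ˣ)`.** (Mathlib instance from `MulArchimedean`.)
[folklore] -/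
theorem archimedean_additive_valueGroup_units (O : ValuationSubring K)
    (hmax : ∀ O₁ : ValuationSubring K, O ≤ O₁ → O₁ = O ∨ O₁ = ⊤) : Archimedean (Additive (ValueGroup O)ˣ) := by
  haveI := mulArchimedean_valueGroup_units O hmax
  infer_instance


/-! ## (rev 2) Class (C) input of `exists_two_level_reading`: rational rank `≤ 2` splits as `1 + 1` over a proper coarsening

Pure `ℤ`-module bookkeeping (no valuations): `W` of `ℤ`-rank `≤ 2` (the port: `ratRank O ≤ 2`, from transcendence defect `≠ 0` and
Abhyankar's inequality in the tree), an additive map `ψ : W → W₁` (the port: the units map of `ValuationSubring.mapOfLE O O₁`, made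
additive) with a non-zero kernel element (`O ≠ O₁`) and a non-zero value (`O₁ ≠ K`), torsion-freeness where needed (ordered groups are
torsion-free).  We prove the two dependence statements `Lens5_UnimodularRefinement.exists_two_level_reading` asks for:
(hΔ) `ker_pair_dependent_of_rank_le_two` — any two kernel elements are `ℤ`-dependent; (hW₁) `image_pair_dependent_of_rank_le_two` — any
two values `ψ w, ψ w'` are `ℤ`-dependent, and `pair_dependent_of_rank_le_two_of_surjective` — the same for all of `W₁` when `ψ` is onto
(`mapOfLE` is).  Each is "three independent elements contradict rank `≤ 2`" (`LinearIndependent.cardinal_le_rank`). -/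

/-- **Three-term linear-independence test over `ℤ` in the `Fin 3` shape.** [folklore] -/
theorem linearIndependent_fin_three {W : Type} [AddCommGroup W] (v : Fin 3 → W)
    (h : ∀ a b c : ℤ, a • v 0 + b • v 1 + c • v 2 = 0 → a = 0 ∧ b = 0 ∧ c = 0) : LinearIndependent ℤ v := by
  rw [Fintype.linearIndependent_iff]
  intro g hg i
  rw [Fin.sum_univ_three] at hg
  obtain ⟨h0, h1, h2⟩ := h (g 0) (g 1) (g 2) hg
  fin_cases i <;> assumption

/-- **From `ℤ`-rank `≤ 2`: no three `ℤ`-linearly independent elements.** [folklore] -/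
theorem not_linearIndependent_three_of_rank_le_two {W : Type} [AddCommGroup W] (hW : Module.rank ℤ W ≤ 2) (v : Fin 3 → W)
    (hv : LinearIndependent ℤ v) : False := by
  have h := hv.cardinal_le_rank
  rw [Cardinal.mk_fin] at h
  have h3 : ((3 : ℕ) : Cardinal.{0}) ≤ ((2 : ℕ) : Cardinal.{0}) := by exact_mod_cast h.trans hW
  exact absurd (Nat.cast_le.mp h3) (by norm_num)

/-- **(hΔ) of `exists_two_level_reading`**: if `rank_ℤ W ≤ 2`, `W₁` is torsion-free and `ψ` takes a non-zero value, any two elements of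
`ker ψ` are `ℤ`-dependent. [folklore] -/
theorem ker_pair_dependent_of_rank_le_two {W W₁ : Type} [AddCommGroup W] [AddCommGroup W₁] [NoZeroSMulDivisors ℤ W₁]
    (hW : Module.rank ℤ W ≤ 2) (ψ : W →+ W₁) (hne : ∃ u : W, ψ u ≠ 0) :
    ∀ w w' : W, ψ w = 0 → ψ w' = 0 → ∃ s t : ℤ, (s ≠ 0 ∨ t ≠ 0) ∧ s • w + t • w' = 0 := by
  intro w w' hw hw'
  obtain ⟨u, hu⟩ := hne
  by_contra H
  have H' : ∀ s t : ℤ, s • w + t • w' = 0 → s = 0 ∧ t = 0 := by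
    intro s t hst
    by_contra h2
    exact H ⟨s, t, by tauto, hst⟩
  refine not_linearIndependent_three_of_rank_le_two hW ![w, w', u] (linearIndependent_fin_three _ fun a b c habc => ?_)
  simp only [Matrix.cons_val_zero, Matrix.cons_val_one, Matrix.cons_val] at habc
  have hc : c = 0 := by
    have := congrArg ψ habc
    rw [map_add, map_add, map_zsmul, map_zsmul, map_zsmul, hw, hw', smul_zero, smul_zero, zero_add, zero_add, map_zero,
      smul_eq_zero] at this
    exact this.resolve_right hu
  rw [hc, zero_smul, add_zero] at habc
  obtain ⟨ha, hb⟩ := H' a b habc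
  exact ⟨ha, hb, hc⟩

/-- **(hW₁) of `exists_two_level_reading`, image form**: if `rank_ℤ W ≤ 2`, `W` is torsion-free and `ker ψ ≠ 0`, any two VALUES `ψ w, ψ w'`
are `ℤ`-dependent. [folklore] -/
theorem image_pair_dependent_of_rank_le_two {W W₁ : Type} [AddCommGroup W] [AddCommGroup W₁] [NoZeroSMulDivisors ℤ W]
    (hW : Module.rank ℤ W ≤ 2) (ψ : W →+ W₁) (hker : ∃ z : W, z ≠ 0 ∧ ψ z = 0) :
    ∀ w w' : W, ∃ s t : ℤ, (s ≠ 0 ∨ t ≠ 0) ∧ s • ψ w + t • ψ w' = 0 := by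
  intro w w'
  obtain ⟨z, hz0, hz⟩ := hker
  by_contra H
  have H' : ∀ s t : ℤ, s • ψ w + t • ψ w' = 0 → s = 0 ∧ t = 0 := by
    intro s t hst
    by_contra h2
    exact H ⟨s, t, by tauto, hst⟩
  refine not_linearIndependent_three_of_rank_le_two hW ![w, w', z] (linearIndependent_fin_three _ fun a b c habc => ?_)
  simp only [Matrix.cons_val_zero, Matrix.cons_val_one, Matrix.cons_val] at habc
  have hab : a = 0 ∧ b = 0 := by
    have := congrArg ψ habc
    rw [map_add, map_add, map_zsmul, map_zsmul, map_zsmul, hz, smul_zero, add_zero, map_zero] at this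
    exact H' a b this
  obtain ⟨ha, hb⟩ := hab
  rw [ha, hb, zero_smul, zero_smul, zero_add, zero_add, smul_eq_zero] at habc
  exact ⟨ha, hb, habc.resolve_right hz0⟩

/-- **(hW₁) for ALL of `W₁`** when `ψ` is surjective (the port: `mapOfLE` is surjective on value groups, every value of `O₁` being the
image of a value of `O`). [folklore] -/
theorem pair_dependent_of_rank_le_two_of_surjective {W W₁ : Type} [AddCommGroup W] [AddCommGroup W₁] [NoZeroSMulDivisors ℤ W]
    (hW : Module.rank ℤ W ≤ 2) (ψ : W →+ W₁) (hψ : Function.Surjective ψ) (hker : ∃ z : W, z ≠ 0 ∧ ψ z = 0) :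
    ∀ w₁ w₁' : W₁, ∃ s t : ℤ, (s ≠ 0 ∨ t ≠ 0) ∧ s • w₁ + t • w₁' = 0 := by
  intro w₁ w₁'
  obtain ⟨w, rfl⟩ := hψ w₁
  obtain ⟨w', rfl⟩ := hψ w₁'
  exact image_pair_dependent_of_rank_le_two hW ψ hker w w'


/-! ## (rev 3) The relation hypothesis `hrel` of the toric lemmas from rank `≤ 2` -/

/-- **`hrel` of `toric_lemma_classB/C`**: three weights in a group of `ℤ`-rank `≤ 2` satisfy a non-trivial `ℤ`-relation — for ANY additive
map `φ` out of a free rank-3 lattice `L` (basis `b`) into `W` with `rank_ℤ W ≤ 2` there is `x ≠ 0` with `φ x = 0`.  (Port: `L = Fin 3 → ℤ`,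
`φ m = Σ mᵢ • γᵢ`, `γᵢ` the values of the parameters; `rank_ℤ W = ratRank O ≤ 2`.) [folklore] -/
theorem exists_ne_zero_map_eq_zero_of_rank_le_two {L W : Type} [AddCommGroup L] [AddCommGroup W] (b : Module.Basis (Fin 3) ℤ L)
    (hW : Module.rank ℤ W ≤ 2) (φ : L →+ W) : ∃ x : L, x ≠ 0 ∧ φ x = 0 := by
  by_contra H
  have hinj : ∀ x : L, φ x = 0 → x = 0 := fun x hx => by
    by_contra hx0
    exact H ⟨x, hx0, hx⟩
  refine not_linearIndependent_three_of_rank_le_two hW (fun i => φ (b i)) (linearIndependent_fin_three _ fun a c d h => ?_)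
  have h' : φ (a • b 0 + c • b 1 + d • b 2) = 0 := by
    rw [map_add, map_add, map_zsmul, map_zsmul, map_zsmul]; exact h
  have h0 := hinj _ h'
  have hc := fun j => congrArg (fun z => b.repr z j) h0
  have e0 := hc 0; have e1 := hc 1; have e2 := hc 2
  simp only [map_add, map_zsmul, map_zero, Finsupp.coe_add, Finsupp.coe_smul, Pi.add_apply, Pi.smul_apply,
    Module.Basis.repr_self, Finsupp.single_apply, Finsupp.coe_zero, Pi.zero_apply, smul_eq_mul] at e0 e1 e2
  simp only [Fin.isValue, ↓reduceIte, OfNat.ofNat_ne_one, Fin.zero_eq_one_iff, one_ne_zero,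
    mul_one, mul_zero, add_zero, zero_add, Fin.reduceEq] at e0 e1 e2
  exact ⟨e0, e1, e2⟩


/-! ## (rev 4) `ratRank O ≤ 2` from the stub's transcendence-defect hypothesis (htd)

The rank hypothesis `Module.rank ℤ W ≤ 2` of the three lemmas above, for `W = Additive (ValueGroup O)ˣ` (so `Module.rank ℤ W = ratRank O`
by `rfl`), from `transcendenceDefect k O hk ≠ 0` and `tr.deg_k K = 3` (the tree's `D + E + F = N`, `TranscendenceDefect.lean`); and the
stub-shaped wrapper deriving `tr.deg_k K = 3` from `dim A = 3`, `K = Frac A` (census pattern). -/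

/-- **`D ≠ 0`, `N = 3` ⟹ `E ≤ 2`.** [folklore] -/
theorem ratRank_le_two_of_transcendenceDefect_ne_zero {k : Type} [Field k] [Algebra k K] (O : ValuationSubring K)
    (hk : ∀ c : k, algebraMap k K c ∈ O) (htr : Algebra.trdeg k K = (3 : ℕ))
    (hD : Literature.AlgebraicGeometry.Resolution.transcendenceDefect k O hk ≠ 0) :
    Module.rank ℤ (Additive (ValuationSubring.ValueGroup O)ˣ) ≤ 2 := by
  have hN : Algebra.trdeg k K < Cardinal.aleph0 := by rw [htr]; exact Cardinal.natCast_lt_aleph0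
  have h := Literature.AlgebraicGeometry.Resolution.transcendenceDefect_add_toNat_eq O hk hN
  rw [htr, Cardinal.toNat_natCast] at h
  have hE : Cardinal.toNat (Literature.AlgebraicGeometry.Resolution.ratRank O) ≤ 2 := by omega
  have hfin := Literature.AlgebraicGeometry.Resolution.ratRank_lt_aleph0 O hk hN
  change Literature.AlgebraicGeometry.Resolution.ratRank O ≤ 2
  rw [← Cardinal.cast_toNat_of_lt_aleph0 hfin]
  exact_mod_cast hE

/-- **The same in the stub's shape**: `K = Frac A`, `A` a finitely generated `k`-subalgebra of Krull dimension `3`, and (htd). [folklore] -/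
theorem ratRank_le_two_of_stub {k : Type} [Field k] [Algebra k K] (O : ValuationSubring K) (A : Subalgebra k K)
    (hAfg : A.FG) [IsFractionRing A K] (hdim : ringKrullDim A = 3)
    (htd : ∀ hk : ∀ c : k, algebraMap k K c ∈ O, Literature.AlgebraicGeometry.Resolution.transcendenceDefect k O hk ≠ 0)
    (hk : ∀ c : k, algebraMap k K c ∈ O) :
    Module.rank ℤ (Additive (ValuationSubring.ValueGroup O)ˣ) ≤ 2 := by
  haveI : Algebra.FiniteType k A := A.fg_iff_finiteType.mp hAfg
  obtain ⟨d, hd, htrA⟩ := Literature.RingTheory.KrullDimension.exists_ringKrullDim_eq_and_trdeg_eq k A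
  have hd3 : d = 3 := by
    rw [hd] at hdim
    exact_mod_cast hdim
  haveI : FaithfulSMul k A := (faithfulSMul_iff_algebraMap_injective k A).mpr (algebraMap k A).injective
  haveI : FaithfulSMul A K := (faithfulSMul_iff_algebraMap_injective A K).mpr (IsFractionRing.injective A K)
  haveI : Algebra.IsAlgebraic A K := IsLocalization.isAlgebraic K (nonZeroDivisors A)
  have htrK : Algebra.trdeg k K = (3 : ℕ) := by
    rw [← trdeg_add_eq k A (A := K), trdeg_eq_zero (R := A) (A := K), add_zero, htrA, hd3]
  exact ratRank_le_two_of_transcendenceDefect_ne_zero O hk htrK (htd hk)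


/-- **`hne` of `exists_two_level_reading` (port row §3 class (C))**: a valuation ring `O₁` of `K` containing a subfield `M` over which `K`
is algebraic is all of `K` — so a PROPER coarsening `O₁ ≠ ⊤` is non-trivial on `M⁺ = Frac T`, i.e. some parameter `zᵢ ∈ 𝔪_{O₁}`.
(Valuation rings are integrally closed; `x` algebraic over the field `M ⊆ O₁` is integral over `O₁`.) [folklore] -/
theorem eq_top_of_subfield_le_of_isAlgebraic (O₁ : ValuationSubring K) (M : Subfield K) (hM : M.toSubring ≤ O₁.toSubring)
    [Algebra.IsAlgebraic M K] : O₁ = ⊤ := by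
  letI : Algebra M O₁ := (Subring.inclusion hM).toAlgebra
  haveI : IsScalarTower M O₁ K := IsScalarTower.of_algebraMap_eq (fun _ => rfl)
  haveI : Algebra.IsIntegral M K := inferInstance
  rw [_root_.eq_top_iff]
  intro x _
  have hx : IsIntegral O₁ x := (Algebra.IsIntegral.isIntegral (R := M) x).tower_top
  obtain ⟨y, hy⟩ := (IsIntegrallyClosed.isIntegral_iff (R := O₁) (K := K)).mp hx
  rw [← hy]
  exact y.2

end Summit.ResolutionOfSingularities.ResolutionOfSingularities.Theorems.RadicialJung.CleanModels.Lens5RankOneArchimedean
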